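import Summits.QuantumFields.BalabanUV.T4Continuum.Support.ShellMeasureLandauEndRayStokesAssembledDecay
import Summits.QuantumFields.BalabanUV.T4Continuum.Support.ShellMeasureLandauEndWindowRestrictRel

/-!
# `T4Continuum.ShellMeasureLandauEndAssembledDecayReach` — «γ3 CARRIED TO THE MOST-ASSEMBLED END», file 1: the END-II-final
# ASSEMBLED AT THE READING OF RECORD (S80 f3) with the window-support binder `hFsupp` REPLACED by the support-relative reach
# reading `hreach′ : u < θ → F ≠ 0 → window` (S87 f2b's host)
(cell `pub-balaban`, sub-cell `t4`, spine estimate NE7c (node U5b); NE7c ROUND-2 crew, unit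
`b2b-balaban-t4-ne7c-formalise-leaf-03` gen 7; owner table `t4/b2b-balaban-t4-ne7c-p1/LEAVES-NE7c-P1.md`: S80 f3
`ShellMeasureLandauEndRayStokesAssembledDecay` p229913 = leaf-09-g12 (the MOST-ASSEMBLED declaration of the END-II-final of
record, R-ne7cp1-g33-3), S87 «audit γ3» (owner g32 f1 p228621; f2 `ShellMeasureLandauEndWindowRestrict` p229117 + f2b
`ShellMeasureLandauEndWindowRestrictRel` p229842 + f4 `ShellMeasureLandauEndWindowReach` p230388 = this lineage; f3 leaf-08-g14;
f5 `ShellMeasureWindowReachCollar` leaf-01-g8); own-initiative OFFER journal l.19205 «γ3 CARRIED TO THE MOST-ASSEMBLED END»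
(the g6 standing offer l.19066), owner GO R-ne7cp1-g33-6 (b) l.19268 = **row S80 f5** (file 2 = S80 f6; ruling in advance: on
f6's landing + outside XREAD its `…_of_core_collar` becomes the most-assembled declaration OF RECORD, S80 f3 stays the
window-binder form, S92 v1 keeps S80 f3); ADDITIVE — imports S80 f3 + S87 f2b ONLY, every supplier consumed BY NAME; the statement is generated
from S80 f3's by deleting `hFsupp` and inserting `hreach′` after `hεθ` (S87 f2b's placement); [folklore]; 0 `def`,
0 `def … : Prop`, 0 sorry, 0 citation tags)

HONEST FRAMING.  Finite four-torus programme, rung (B)+1 only — NOT infinite volume, NOT a mass gap, NOT the Clay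
problem, NOT summit progress; (B), `BetaPertHyp`, (B^μ) not consumed.  NE7c (`T4IndicatorShell.ShellWeightBound`) is
NOT PRINTED in [Balaban 1983–89] and NOT PROVED; «NE7c ⇐ the named binders» (trigger c3); (M1) realized ≠ NE7c.
Nothing printed is asserted: the equation numbers in binder comments LOCATE displayed SHAPES ((P2), (P4), (118)∕(121),
(103), (75), (44), (46), (54); B9 (3.133)∕Thm 3.3; B11 (19)∕(25)∕(37); B12 (2.18)–(2.22); B14 (2.16)∕(2.17); B15 (1.3)–(1.9);
[Balaban1985Averaging] Props 1∕2), not citations; no estimate of Bałaban's is discharged.  HONEST DEPENDENCY (cell):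
continuum YM on T⁴ ⇐ BetaPertH ∧ nine spine estimates (0/9 proved); BetaPertH ⇐ (D1) ∧ (D4) ∧ CAP+tail; G-an2-4 gates
asym, D1 and NE2/3/4.

THE POINT.  The owner's audit γ3 (N-ne7cp1-g32-2, amended N-ne7cp1-g33-2 «COLLAR») showed that the live-level END's window
binder `hFsupp` («sections vanish unless every block bond is within `2 sin(S∕2)` of the centre») is inhabited by RESTRICTION
to the slot's own sub-threshold event `{u < θ}` (kernel, S87 f1) + S1's axial reach on the box (kernel, S87 f3) + the PAIR
of located readings (core from `u < θ`, collar from the density's kept co-tests).  That wiring was done at the OPEN-SLOT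
host S76 f2 (S87 f2∕f2b∕f4).  This file carries it to the MOST-ASSEMBLED declaration of record, as R-ne7cp1-g32-4 carried γ6:
* **`slotAC_realized_su2_landauChart_assembled_decay_of_reach'`** — S80 f3's hypotheses VERBATIM except `hFsupp`, REPLACED by
  `hreach′ : u(W) < εθ·η² → F(W) ≠ 0 → ∀ b ∈ Λ, dist1((c V b)⁻¹·y_b) ≤ 2 sin(S∕2)`; conclusion IDENTICAL to S80 f3's (the
  located second-order Wilson constant written out).  Proof: S80 f3's body with its inner host S76 f2 `…_final` replaced by
  S87 f2b `…_final_of_reach'` — the (T2) Wilson slot by S85 f2 file 4 `hE_landau_wilsonSquares_located_schwarz_of_decay`,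
  the non-Wilson slot by S71 f2 `hE_landau_chartRay_pinned` ⊕ S78 `rayBound_of_logIntegral`, `hWlb` by S80
  `wilsonProfile_nonneg`, EXACTLY as S80 f3.
File 2 (`ShellMeasureLandauEndAssembledDecayReachBox`) specialises to the block's box with leaf-01-g8's
`ShellMeasureWindowReachCollar.hreach'_of_core_collar` — the γ3 PAIR displayed, NEITHER `hFsupp` NOR `hreach′` left.
WHAT REMAINS A BINDER (c2∕c3): everything S80 f3 lists (the three scheme tuples, decay kernels with row sums, localities,
block support, blind read-outs, located budgets `K_w`, `LK`, `B_d`, lower bounds, co-test data, numbers, [dict]) and the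
reading `hreach′`.  NOTHING in the countdown moves; NE7c NOT PROVED; spine PROVED 0∕9.
-/

noncomputable section

open Set Metric NormedSpace MeasureTheory Function

namespace Summit.QuantumFields.BalabanUV.T4Continuum.ShellMeasureLandauEndAssembledDecayReach

open scoped ENNReal
open Literature.MathematicalPhysics.QuantumFieldTheory.Balaban1983to89
open B11Prop6Scheme (Prop4Hyp)
open GaugeField (GaugeInvariant)
open T4ShellMeasure (SlotAntiConcentration)
open T4CubePoincare (cube)
open T4CubeChartGnomonic (SU2)
open T4CubeChartExp (expFibreChart)
open T4TreeGaugeFixing (NoClosedLoop fixTo)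
open T4ShellMeasurePlaquette (expTail₂)
open ShellMeasureLevelAssembly (classifier)
open ShellMeasureMultiGridNorms (WSup)
open ShellMeasurePinnedNorm (pinW)
open ShellMeasureLandauHolonomy (solAt landauExp)
open ShellMeasureLandauHolonomyChart (holOf cplx)
open ShellMeasureLandauHolonomySkew (readOutReal)
open ShellMeasureRayTermsPinnedLandau (hE_landau_chartRay_pinned)
open ShellMeasureRayLogIntegral (rayBound_of_logIntegral rayBound_add)
open ShellMeasureLandauEndWindowRestrictRel (slotAC_realized_su2_landauChart_final_of_reach')
open ShellMeasureLandauEndRayStokesAssembled (wilsonProfile_nonneg)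
open ShellMeasureDecayKernelSums (kerOp)
open ShellMeasureLandauWilsonSquaresKernelsSchwarz (hE_landau_wilsonSquares_located_schwarz_of_decay)

/-! ## END-II-final ASSEMBLED at the reading of record, window binder ↦ support-relative reach reading -/

section Assembled

open scoped Matrix.Norms.L2Operator

variable {P : Params} {j : ℕ} [DecidableEq (PBond P j)]
variable {n : Type*} [Fintype n] [DecidableEq n] [Nonempty n]
variable {𝒴 𝒴' 𝒳 𝒵 ℬ : Type*} [NormedAddCommGroup 𝒴] [NormedSpace ℂ 𝒴] [CompleteSpace 𝒴]
  [NormedAddCommGroup 𝒴'] [NormedSpace ℂ 𝒴'] [NormedAddCommGroup 𝒳] [NormedSpace ℂ 𝒳] [CompleteSpace 𝒳]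
  [NormedAddCommGroup 𝒵] [NormedSpace ℂ 𝒵] [NormedAddCommGroup ℬ] [NormedSpace ℂ ℬ]

/-- **END-II-FINAL, ASSEMBLED AT THE READING OF RECORD, WITH THE SUPPORT-RELATIVE REACH READING** («γ3 carried to the
most-assembled END», file 1).  Hypotheses: those of S80 f3
`ShellMeasureLandauEndRayStokesAssembledDecay.slotAC_realized_su2_landauChart_assembled_decay` VERBATIM — the (T1) localized
scheme tuple, the (T2) Wilson supplier data at the reading of record (five flat pi-type chain spaces, one pin profile, the
four linear letters as V-indexed DECAY KERNELS with reduced-rate row sums, the flat printed-TYPE lists, localities with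
reaches, block support, blind flat read-outs, frozen background plaquettes, located count `K_w`), the (T3) located non-Wilson
terms' pinned tuple with `LK`, the (S78) dressed terms with `B_d`, real structure, [dict] `hRdict`∕`hudict`, co-tests,
numbers, (SM) in the Stokes currency — EXCEPT the window-support binder `hFsupp`, REPLACED by
`hreach′ : u(W) < εθ·η² → F(W) ≠ 0 → every block bond of W within 2 sin(S∕2) of the centre` (the γ3 input in its honest
support-relative form: the sub-threshold event windows `□^∼`, the density's kept co-tests window the collar — located
readings of printed TYPE, NOT asserted).  CONCLUSION — IDENTICAL to S80 f3's: (M1) per slot at the classifier threshold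
`εθ·η²` with the slot constant `2(m₀ + (B_W⁽²⁾ + (3·LK·2z̄_e∕(r_Φ,e∕S − 1) + B_d)))∕(1 − δ)`, `B_W⁽²⁾` the located second-order
Wilson constant written out.  Proof: S80 f3's body with the inner host S87 f2b `…_final_of_reach'` in place of S76 f2
`…_final`.  CONDITIONAL on every binder; nothing PRINTED is asserted; NOT Bałaban's minimiser; (M1) realized ≠ NE7c.
[folklore] -/
theorem slotAC_realized_su2_landauChart_assembled_decay_of_reach' {T : Finset (PBond P j)} (hT : NoClosedLoop T)
    (U₀ : GaugeField P j SU2) (Λ : Finset (PBond P j)) {m₀ : ℕ} (e : ↥Λ × Fin 3 ≃ Fin m₀)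
    {S : ℝ} (hS : 0 < S) (hSπ : 3 * S ^ 2 < Real.pi ^ 2) (c : GaugeField P j SU2 → GaugeField P j SU2)
    {F : GaugeField P j SU2 → ℝ≥0∞} (hF : Measurable F) (hFi : GaugeInvariant F)
    {u : GaugeField P j SU2 → ℝ} (hu : Measurable u) (hui : GaugeInvariant u)
    {ι : Type*} {Pu : Finset ι} (hPu : Pu.Nonempty)
    (W : GaugeField P j SU2 → Set (Fin m₀ → ℝ)) (Jco : GaugeField P j SU2 → (Fin m₀ → ℝ) → ℝ≥0∞)
    {δ ρ β : ℝ}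
    (𝒢 : GaugeField P j SU2 → (𝒵 →L[ℂ] 𝒴)) (W𝒱 : GaugeField P j SU2 → 𝒴 → 𝒵) {B₀ C₄ a₃ ε₄ : ℝ}
    (h𝒢 : ∀ V f, ‖𝒢 V f‖ ≤ B₀ * ‖f‖) (hW : ∀ V, Prop4Hyp (W𝒱 V) C₄ a₃) (hB₀ : 0 < B₀) (hC₄ : 0 ≤ C₄)
    (hε₄ : 0 ≤ ε₄)
    {dL C₁ B₃ ε₁ : ℝ} (hdL : 0 ≤ dL) (hC₁ : 0 ≤ C₁) (hε₁ : 0 ≤ ε₁) (hB₃ : dL ≤ B₃)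
    (h1 : 2 * B₀ * C₁ * B₃ * ε₁ ≤ ε₄) (h2 : 4 * ε₄ ≤ a₃) (h3 : 16 * B₀ * C₄ * ε₄ ≤ 1)
    (H₁ : GaugeField P j SU2 → (ℬ →L[ℂ] 𝒴)) (hH₁ : ∀ V B, ‖H₁ V B‖ ≤ B₀ * ‖B‖)
    (Φ : GaugeField P j SU2 → (Fin m₀ → ℂ) → ℬ) {rΦ : ℝ} (hΦd : ∀ V, DifferentiableOn ℂ (Φ V) (ball 0 rΦ))
    (hΦ0 : ∀ V, Φ V 0 = 0) (hΦ : ∀ V, ∀ z ∈ ball (0 : Fin m₀ → ℂ) rΦ, ‖Φ V z‖ < 2 * dL * C₁ * ε₁) (hSr : S < rΦ)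
    (Cf : GaugeField P j SU2 → 𝒴' → 𝒳) {C₂ RC : ℝ} (hC₂ : 0 ≤ C₂)
    (hCq : ∀ V, ∀ Z : 𝒴', ‖Z‖ < RC → ‖Cf V Z‖ ≤ C₂ * ‖Z‖ ^ 2) (hCd : ∀ V, DifferentiableOn ℂ (Cf V) (ball 0 RC))
    (ιs : GaugeField P j SU2 → (𝒴 →L[ℂ] 𝒴')) (hι : ∀ V Y, ‖ιs V Y‖ ≤ ‖Y‖)
    (Hop : GaugeField P j SU2 → (𝒳 →L[ℂ] 𝒴)) (hH : ∀ V X, ‖Hop V X‖ ≤ B₀ * ‖X‖)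
    {ε₃ : ℝ} (h18 : 18 * C₂ * B₀ * ε₃ ≤ 1) (hcoup : ε₄ + B₀ * (2 * dL * C₁ * ε₁) ≤ ε₃) (h3R : 3 * ε₃ ≤ RC)
    (ℓs : ι → List (𝒴 →L[ℂ] Matrix n n ℂ)) {κr : ℝ} (hκ : 0 ≤ κr)
    (hℓ : ∀ p ∈ Pu, ∀ ℓ ∈ ℓs p, ∀ Y, ‖ℓ Y‖ ≤ κr * ‖Y‖) {m : ℕ} (hlen : ∀ p ∈ Pu, (ℓs p).length ≤ m)
    {κc : ℝ} (hκc : 0 ≤ κc) (hcurl : ∀ p ∈ Pu, ∀ Y, ‖((ℓs p).map fun ℓ => ℓ Y).sum‖ ≤ κc * ‖Y‖)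
    -- ══ (T2) THE WILSON SLOT'S SUPPLIER DATA AT THE READING OF RECORD (file 4
    -- `ShellMeasureLandauWilsonSquaresKernelsSchwarz.hE_landau_wilsonSquares_located_schwarz_of_decay`, per exterior section `V`,
    -- V-uniform constants): five FLAT pi-type chain spaces, ONE pin profile on a common position space (one-sided Lipschitz),
    -- the four linear letters as V-indexed DECAY KERNELS with reduced-rate row sums ((3.133)∕Thm 3.3, (46), (103) decay-halves
    -- TYPE — LOCATORS), the flat printed-TYPE lists, two localities with reaches, the block support of the coarse field, blind
    -- flat read-outs, the located count — NOTHING PINNED DISPLAYED; the Wilson budget LOCATED and SECOND ORDER (γ6) ══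
    {Λw Λz Λw' Λx Λb 𝔖 : Type*} [Fintype Λw] [DecidableEq Λw] [Fintype Λz] [Fintype Λw'] [Fintype Λx] [Fintype Λb]
    {𝔄w ℭ 𝔄' 𝔅 𝔇 : Type*} [NormedAddCommGroup 𝔄w] [NormedSpace ℂ 𝔄w] [CompleteSpace 𝔄w]
    [NormedAddCommGroup ℭ] [NormedSpace ℂ ℭ] [NormedAddCommGroup 𝔄'] [NormedSpace ℂ 𝔄']
    [NormedAddCommGroup 𝔅] [NormedSpace ℂ 𝔅] [CompleteSpace 𝔅] [NormedAddCommGroup 𝔇] [NormedSpace ℂ 𝔇]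
    {δw : ℝ} (hδw : 0 ≤ δw) (ϖw : 𝔖 → ℝ) (dis : 𝔖 → 𝔖 → ℝ) (hϖw : ∀ x y, ϖw x ≤ ϖw y + dis x y)
    (pos : Λw → 𝔖) (posz : Λz → 𝔖) (pos' : Λw' → 𝔖) (posx : Λx → 𝔖) (posb : Λb → 𝔖)
    (k𝒢 : GaugeField P j SU2 → Λw → Λz → (ℭ →L[ℂ] 𝔄w)) (kι : GaugeField P j SU2 → Λw' → Λw → (𝔄w →L[ℂ] 𝔄'))
    (kH : GaugeField P j SU2 → Λw → Λx → (𝔅 →L[ℂ] 𝔄w)) (kH₁ : GaugeField P j SU2 → Λw → Λb → (𝔇 →L[ℂ] 𝔄w))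
    {c𝒢 δ𝒢 M𝒢 cι δι Mι cH δH MH cH₁ δH₁ MH₁ : ℝ}
    (hc𝒢 : 0 ≤ c𝒢) (hM𝒢 : 0 ≤ M𝒢) (hk𝒢 : ∀ V c b', ‖k𝒢 V c b'‖ ≤ c𝒢 * Real.exp (-(δ𝒢 * dis (pos c) (posz b'))))
    (hM𝒢' : ∀ x, ∑ b', Real.exp (-((δ𝒢 - δw) * dis x (posz b'))) ≤ M𝒢)
    (hcι : 0 ≤ cι) (hMι : 0 ≤ Mι) (hkι : ∀ V c b', ‖kι V c b'‖ ≤ cι * Real.exp (-(δι * dis (pos' c) (pos b'))))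
    (hMι' : ∀ x, ∑ b', Real.exp (-((δι - δw) * dis x (pos b'))) ≤ Mι)
    (hcH : 0 ≤ cH) (hMH : 0 ≤ MH) (hkH : ∀ V c b', ‖kH V c b'‖ ≤ cH * Real.exp (-(δH * dis (pos c) (posx b'))))
    (hMH' : ∀ x, ∑ b', Real.exp (-((δH - δw) * dis x (posx b'))) ≤ MH)
    (hcH₁ : 0 ≤ cH₁) (hMH₁ : 0 ≤ MH₁) (hkH₁ : ∀ V c b', ‖kH₁ V c b'‖ ≤ cH₁ * Real.exp (-(δH₁ * dis (pos c) (posb b'))))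
    (hMH₁' : ∀ x, ∑ b', Real.exp (-((δH₁ - δw) * dis x (posb b'))) ≤ MH₁)
    -- the flat lists (P2)∕(P4)∕(118)∕(121)∕(103)∕(75)-TYPE∕(44) at radius `RCw` with `6(ε₄w + B₀w·bw) ≤ RCw`∕scaling∕(46)∕(54)
    (W𝒱w : GaugeField P j SU2 → (Λw → 𝔄w) → (Λz → ℭ)) {B₀w C₄w a₃w ε₄w bw : ℝ}
    (h𝒢w : ∀ V f, ‖kerOp (k𝒢 V) f‖ ≤ B₀w * ‖f‖) (hWw : ∀ V, Prop4Hyp (W𝒱w V) C₄w a₃w) (hB₀w : 0 < B₀w) (hC₄w : 0 ≤ C₄w)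
    (hε₄w : 0 ≤ ε₄w) (hdomw : 2 * (ε₄w + B₀w * bw) ≤ a₃w) (hselfw : B₀w * C₄w * (ε₄w + B₀w * bw) ^ 2 ≤ ε₄w)
    (hcontrw : 4 * B₀w * C₄w * (ε₄w + B₀w * bw) < 1) (hH₁w : ∀ V B, ‖kerOp (kH₁ V) B‖ ≤ B₀w * ‖B‖)
    (Φw : GaugeField P j SU2 → (Fin m₀ → ℂ) → (Λb → 𝔇)) {rΦw : ℝ} (hΦdw : ∀ V, DifferentiableOn ℂ (Φw V) (ball 0 rΦw))
    (hΦ0w : ∀ V, Φw V 0 = 0) (hΦbw : ∀ V, ∀ z ∈ ball (0 : Fin m₀ → ℂ) rΦw, ‖Φw V z‖ < bw) (h2Sw : 2 * S ≤ rΦw)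
    (Cw : GaugeField P j SU2 → (Λw' → 𝔄') → (Λx → 𝔅)) {C₂w RCw : ℝ} (hC₂w : 0 ≤ C₂w)
    (hCqw : ∀ V, ∀ Z : Λw' → 𝔄', ‖Z‖ < RCw → ‖Cw V Z‖ ≤ C₂w * ‖Z‖ ^ 2) (hCdw : ∀ V, DifferentiableOn ℂ (Cw V) (ball 0 RCw))
    (hιw : ∀ V Y, ‖kerOp (kι V) Y‖ ≤ ‖Y‖) (hHw : ∀ V X, ‖kerOp (kH V) X‖ ≤ B₀w * ‖X‖)
    (hqw : 9 * C₂w * B₀w * (ε₄w + B₀w * bw) < 1) (hRCw : 6 * (ε₄w + B₀w * bw) ≤ RCw)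
    -- localities with reaches, the block support, the two contraction numbers (DISPLAYED arithmetic on the decay constants)
    (NW : Λz → Λw → Prop)
    (hlocW : ∀ V, ∀ A A' : Λw → 𝔄w, ∀ c', (∀ b', NW c' b' → A b' = A' b') → W𝒱w V A c' = W𝒱w V A' c')
    {rW : ℝ} (hreachW : ∀ c' b', NW c' b' → ϖw (posz c') - rW ≤ ϖw (pos b'))
    (NC : Λx → Λw' → Prop)
    (hlocC : ∀ V, ∀ A A' : Λw' → 𝔄', ∀ c', (∀ b', NC c' b' → A b' = A' b') → Cw V A c' = Cw V A' c')
    {rC : ℝ} (hreachC : ∀ c' b', NC c' b' → ϖw (posx c') - rC ≤ ϖw (pos' b'))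
    (hsupp : ∀ V, ∀ z : Fin m₀ → ℂ, ∀ i, 0 < ϖw (posb i) → Φw V z i = 0)
    (hqW : c𝒢 * M𝒢 * (2 * C₄w * a₃w * Real.exp (δw * rW)) < 1)
    (hk : 2 * C₂w * RCw * Real.exp (δw * rC) * (cι * Mι) * (cH * MH) < 1)
    -- weight plaquettes; read-outs BLIND off located supports, FLAT op-norms, curl op-norm (DISPLAYED; `κ_c ∝ η²`), lengths
    {𝔭 : Type*} (Pw : Finset 𝔭) (ℓw : 𝔭 → List ((Λw → 𝔄w) →L[ℂ] Matrix n n ℂ)) (suppw : 𝔭 → Finset Λw)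
    (ϖPw : 𝔭 → ℝ)
    (hblindw : ∀ p ∈ Pw, ∀ ℓ ∈ ℓw p, ∀ A A' : Λw → 𝔄w, (∀ b' ∈ suppw p, A b' = A' b') → ℓ A = ℓ A')
    (hdepthw : ∀ p ∈ Pw, ∀ b' ∈ suppw p, ϖPw p ≤ ϖw (pos b')) (hϖPw : ∀ p ∈ Pw, 0 ≤ ϖPw p)
    {κwb κcb : ℝ} (hκwb : 0 ≤ κwb) (hκcb : 0 ≤ κcb) (hℓwb : ∀ p ∈ Pw, ∀ ℓ ∈ ℓw p, ‖ℓ‖ ≤ κwb)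
    (hcurlw : ∀ p ∈ Pw, ‖(ℓw p).sum‖ ≤ κcb)
    {mw : ℕ} (hlenw : ∀ p ∈ Pw, (ℓw p).length ≤ mw)
    -- the global tuple's real structure with SKEW weight read-outs
    (𝓡𝒴w : AddSubgroup (Λw → 𝔄w)) (h𝓡𝒴w : IsClosed (𝓡𝒴w : Set (Λw → 𝔄w))) (𝓡𝒵w : AddSubgroup (Λz → ℭ))
    (𝓡𝒴w' : AddSubgroup (Λw' → 𝔄')) (𝓡𝒳w : AddSubgroup (Λx → 𝔅)) (h𝓡𝒳w : IsClosed (𝓡𝒳w : Set (Λx → 𝔅)))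
    (𝓡ℬw : AddSubgroup (Λb → 𝔇))
    (h𝒢rw : ∀ V, ∀ f ∈ 𝓡𝒵w, kerOp (k𝒢 V) f ∈ 𝓡𝒴w) (hWrw : ∀ V, ∀ Y ∈ 𝓡𝒴w, W𝒱w V Y ∈ 𝓡𝒵w)
    (hιrw : ∀ V, ∀ Y ∈ 𝓡𝒴w, kerOp (kι V) Y ∈ 𝓡𝒴w') (hHrw : ∀ V, ∀ X ∈ 𝓡𝒳w, kerOp (kH V) X ∈ 𝓡𝒴w)
    (hCrw : ∀ V, ∀ Z ∈ 𝓡𝒴w', Cw V Z ∈ 𝓡𝒳w) (hH₁rw : ∀ V, ∀ B ∈ 𝓡ℬw, kerOp (kH₁ V) B ∈ 𝓡𝒴w)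
    (hΦrw : ∀ V, ∀ y : Fin m₀ → ℝ, ‖y‖ ≤ S → Φw V (cplx y) ∈ 𝓡ℬw)
    (hskew : ∀ p ∈ Pw, ∀ ℓ ∈ ℓw p, ∀ Y ∈ 𝓡𝒴w, ℓ Y ∈ skewAdjoint (Matrix n n ℂ))
    -- the frozen background plaquettes (N-ne7cp1-g31-2) with a uniform size bound, the located count, `0 ≤ β`
    (Bp : GaugeField P j SU2 → 𝔭 → Matrix n n ℂ) {d : 𝔭 → ℝ} {dbar : ℝ}
    (hBu : ∀ V, ∀ p ∈ Pw, Bp V p ∈ unitary (Matrix n n ℂ)) (hBd : ∀ V, ∀ p ∈ Pw, ‖Bp V p - 1‖ ≤ d p)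
    (hd : ∀ p ∈ Pw, d p ≤ dbar) (hdbar : 0 ≤ dbar)
    {Kw : ℝ} (hKw : ∑ p ∈ Pw, Real.exp (-(δw * ϖPw p)) ≤ Kw)
    -- ══ (T3) THE LOCATED NON-WILSON TERMS' SUPPLIER DATA (S71 f2 `hE_landau_chartRay_pinned`): the global tuple's PINNED
    -- INSTANCE `𝒴 := WSup (pinW δ′ ϖ) 1 𝔄`, located per-term functionals, pin depths, located sum `LK`, coupling ══
    {Λe : Type*} [Fintype Λe] {𝔄 : Type*} [NormedAddCommGroup 𝔄] [NormedSpace ℂ 𝔄] [CompleteSpace 𝔄] {δ' : ℝ} {ϖ : Λe → ℝ}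
    (hδ' : 0 ≤ δ') (hϖ : ∀ b', 0 ≤ ϖ b')
    {𝒴e' 𝒳e 𝒵e ℬe : Type*} [NormedAddCommGroup 𝒴e'] [NormedSpace ℂ 𝒴e'] [NormedAddCommGroup 𝒳e] [NormedSpace ℂ 𝒳e]
    [CompleteSpace 𝒳e] [NormedAddCommGroup 𝒵e] [NormedSpace ℂ 𝒵e] [NormedAddCommGroup ℬe] [NormedSpace ℂ ℬe]
    (𝒢e : GaugeField P j SU2 → (𝒵e →L[ℂ] WSup (pinW δ' ϖ) 1 𝔄)) (W𝒱e : GaugeField P j SU2 → WSup (pinW δ' ϖ) 1 𝔄 → 𝒵e)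
    {B₀e C₄e a₃e be ε₄e : ℝ}
    (h𝒢e : ∀ V f, ‖𝒢e V f‖ ≤ B₀e * ‖f‖) (hWe : ∀ V, Prop4Hyp (W𝒱e V) C₄e a₃e) (hB₀e : 0 < B₀e) (hC₄e : 0 ≤ C₄e)
    (hbe : 0 ≤ be) (hε₄e : 0 ≤ ε₄e) (hdome : 2 * (ε₄e + B₀e * be) ≤ a₃e)
    (hselfe : B₀e * C₄e * (ε₄e + B₀e * be) ^ 2 ≤ ε₄e) (hcontre : 4 * B₀e * C₄e * (ε₄e + B₀e * be) < 1)
    (H₁e : GaugeField P j SU2 → (ℬe →L[ℂ] WSup (pinW δ' ϖ) 1 𝔄)) (hH₁e : ∀ V B, ‖H₁e V B‖ ≤ B₀e * ‖B‖)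
    (Φe : GaugeField P j SU2 → (Fin m₀ → ℂ) → ℬe) {rΦe : ℝ} (hΦde : ∀ V, DifferentiableOn ℂ (Φe V) (ball 0 rΦe))
    (hΦ0e : ∀ V, Φe V 0 = 0) (hΦbe : ∀ V, ∀ z ∈ ball (0 : Fin m₀ → ℂ) rΦe, ‖Φe V z‖ < be) (hSre : S < rΦe)
    (Ce : GaugeField P j SU2 → 𝒴e' → 𝒳e) {C₂e RCe : ℝ} (hC₂e : 0 ≤ C₂e)
    (hCqe : ∀ V, ∀ Z : 𝒴e', ‖Z‖ < RCe → ‖Ce V Z‖ ≤ C₂e * ‖Z‖ ^ 2) (hCde : ∀ V, DifferentiableOn ℂ (Ce V) (ball 0 RCe))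
    (ιe : GaugeField P j SU2 → (WSup (pinW δ' ϖ) 1 𝔄 →L[ℂ] 𝒴e')) (hιe : ∀ V Y, ‖ιe V Y‖ ≤ ‖Y‖)
    (He : GaugeField P j SU2 → (𝒳e →L[ℂ] WSup (pinW δ' ϖ) 1 𝔄)) (hHe : ∀ V X, ‖He V X‖ ≤ B₀e * ‖X‖)
    (hqe : 9 * C₂e * B₀e * (ε₄e + B₀e * be) < 1) (hRCe : 3 * (ε₄e + B₀e * be) ≤ RCe)
    {𝔱 : Type*} (I : Finset 𝔱) {Ef : 𝔱 → (Λe → 𝔄) → ℂ} {rE : ℝ} {ee : 𝔱 → ℝ} (hrE : 0 < rE)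
    (hEd : ∀ i ∈ I, DifferentiableOn ℂ (Ef i) (ball 0 rE))
    (hEb : ∀ i ∈ I, ∀ Z ∈ ball (0 : Λe → 𝔄) rE, ‖Ef i Z‖ ≤ ee i) (he0 : ∀ i ∈ I, 0 ≤ ee i)
    (supp : 𝔱 → Finset Λe) (hblind : ∀ i ∈ I, ∀ A₁ A₂ : Λe → 𝔄, (∀ b' ∈ supp i, A₁ b' = A₂ b') → Ef i A₁ = Ef i A₂)
    (ϖP : 𝔱 → ℝ) (hdepth : ∀ i ∈ I, ∀ b' ∈ supp i, ϖP i ≤ ϖ b')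
    {LK : ℝ} (hLK : 0 ≤ LK) (hK : ∑ i ∈ I, 2 * ee i / rE * Real.exp (-(δ' * ϖP i)) ≤ LK)
    (hcoupE : ((ε₄e + B₀e * be) + B₀e * (4 * C₂e * (ε₄e + B₀e * be) ^ 2)) ≤ rE / 2)
    {BE₁ : ℝ} (hElb₁ : ∀ V (y : Fin m₀ → ℝ), ‖y‖ ≤ S → -BE₁ ≤
      (∑ i ∈ I, Ef i (WSup.toPiL (𝔄 := 𝔄) (pinW δ' ϖ) 1
        (landauExp (Ce V) (ιe V) (He V) (4 * C₂e * (ε₄e + B₀e * be) ^ 2)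
          (solAt (𝒢e V) 0 (W𝒱e V) ε₄e (0 : 𝒵e) (H₁e V (Φe V (cplx y))) + H₁e V (Φe V (cplx y)))))).re)
    -- ══ (S78) THE FLUCTUATION-DRESSED TERMS: `−log ∫ g e^{A} dμ` with an ω-UNIFORM ray constant `B_d`, integrability and
    -- positivity of the dressed integral, a lower bound on the S-ball (all DISPLAYED) ══
    {Ω : Type*} [MeasurableSpace Ω] (μ : Measure Ω) {g : Ω → ℝ} (hg : ∀ ω, 0 ≤ g ω)
    (A : GaugeField P j SU2 → (Fin m₀ → ℝ) → Ω → ℝ) {Bd : ℝ} (hBd0 : 0 ≤ Bd)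
    (hint : ∀ V, ∀ x ∈ W V, ∀ c : ℝ, 1 / 2 ≤ c → c ≤ 1 → Integrable (fun ω => g ω * Real.exp (A V (c • x) ω)) μ)
    (hpos : ∀ V, ∀ x ∈ W V, ∀ c : ℝ, 1 / 2 ≤ c → c ≤ 1 → 0 < ∫ ω, g ω * Real.exp (A V (c • x) ω) ∂μ)
    (hA : ∀ V, ∀ x ∈ W V, ∀ c : ℝ, 1 / 2 ≤ c → c ≤ 1 → ∀ ω, A V x ω ≤ A V (c • x) ω + (1 - c) * Bd)
    {BE₂ : ℝ} (hElb₂ : ∀ V (y : Fin m₀ → ℝ), ‖y‖ ≤ S → -BE₂ ≤ (-Real.log (∫ ω, g ω * Real.exp (A V y ω) ∂μ)))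
    (L : Set (𝒴 →L[ℂ] Matrix n n ℂ))
    (𝓡𝒵 : AddSubgroup 𝒵) (𝓡𝒴' : AddSubgroup 𝒴') (𝓡𝒳 : AddSubgroup 𝒳) (h𝓡𝒳 : IsClosed (𝓡𝒳 : Set 𝒳))
    (𝓡ℬ : AddSubgroup ℬ)
    (h𝒢r : ∀ V, ∀ f ∈ 𝓡𝒵, 𝒢 V f ∈ readOutReal L) (hWr : ∀ V, ∀ Y ∈ readOutReal L, W𝒱 V Y ∈ 𝓡𝒵)
    (hιr : ∀ V, ∀ Y ∈ readOutReal L, ιs V Y ∈ 𝓡𝒴') (hHr : ∀ V, ∀ X ∈ 𝓡𝒳, Hop V X ∈ readOutReal L)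
    (hCr : ∀ V, ∀ Z ∈ 𝓡𝒴', Cf V Z ∈ 𝓡𝒳) (hH₁r : ∀ V, ∀ B ∈ 𝓡ℬ, H₁ V B ∈ readOutReal L)
    (hΦr : ∀ V, ∀ y : Fin m₀ → ℝ, ‖y‖ ≤ S → Φ V (cplx y) ∈ 𝓡ℬ)
    (hRdict : ∀ V, ∀ x ∈ cube m₀ S,
      F (fixTo T U₀ (updateFinset V Λ (expFibreChart Λ (c V) e x))) =
        Jco V x * ENNReal.ofReal (Real.exp (-((∑ p ∈ Pw, β * (1 - (Matrix.trace (Bp V p * holOf (ℓw p)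
            (fun y => landauExp (Cw V) (kerOp (kι V)) (kerOp (kH V)) (4 * C₂w * (ε₄w + B₀w * bw) ^ 2)
              (solAt (kerOp (k𝒢 V)) 0 (W𝒱w V) ε₄w (0 : Λz → ℭ) (kerOp (kH₁ V) (Φw V (cplx y))) +
                kerOp (kH₁ V) (Φw V (cplx y)))) x)).re /
            Fintype.card n)) +
          ((∑ i ∈ I, Ef i (WSup.toPiL (𝔄 := 𝔄) (pinW δ' ϖ) 1
            (landauExp (Ce V) (ιe V) (He V) (4 * C₂e * (ε₄e + B₀e * be) ^ 2)
              (solAt (𝒢e V) 0 (W𝒱e V) ε₄e (0 : 𝒵e) (H₁e V (Φe V (cplx x))) + H₁e V (Φe V (cplx x)))))).re +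
          (-Real.log (∫ ω, g ω * Real.exp (A V x ω) ∂μ)))))))
    (hudict : ∀ V, ∀ x ∈ cube m₀ S,
      u (fixTo T U₀ (updateFinset V Λ (expFibreChart Λ (c V) e x))) =
        classifier hPu (fun p => holOf (ℓs p) (fun y => landauExp (Cf V) (ιs V) (Hop V)
          (4 * C₂ * (ε₄ + B₀ * (2 * dL * C₁ * ε₁)) ^ 2)
          (solAt (𝒢 V) 0 (W𝒱 V) ε₄ (0 : 𝒵) (H₁ V (Φ V (cplx y))) + H₁ V (Φ V (cplx y))))) x)
    (hJW : ∀ V x, Jco V x ≠ 0 → x ∈ W V)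
    (hJ : ∀ V x, ∀ a : ℝ, 0 ≤ a → Jco V x ≤ Jco V (Real.exp (-a) • x))
    (hJ1 : ∀ V x, Jco V x ≤ 1)
    (hWS : ∀ V, W V ⊆ closedBall (0 : Fin m₀ → ℝ) S)
    (hδ0 : 0 ≤ δ) (hδ1 : δ < 1) (hρ0 : 0 ≤ ρ) (hρ : ρ ≤ (1 - δ) / 2) (hβ : 0 ≤ β)
    -- SM-L2 (SM) DISCHARGED IN THE STOKES CURRENCY (S73 `hSM_of_stokes`): the η-scalings of the classifier's read-out data
    -- DISPLAYED — curl read-out × field size `κ_c·z̄ ≤ c₁η²z` (B11 (25)∕(37) TYPE), letter size `κ_r·z̄ ≤ c₂ηz` ((19) TYPE),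
    -- regime `m·κ_r·z̄ ≤ 1` — the UNIT-currency smallness `36(c₁z + m²c₂²z²)∕(r_Φ∕S − 1)² ≤ δ·εθ`, and the classifier
    -- threshold `θ := εθ·η²` (B14 (2.17) TYPE): the `η²` CANCELS
    {η εθ c₁ c₂ z : ℝ} (hη : 0 < η) (hεθ : 0 < εθ)
    -- THE SUPPORT-RELATIVE REACH READING (S87 f2b; produced on the block's box by leaf-01-g8's
    -- `ShellMeasureWindowReachCollar.hreach'_of_core_collar` from the γ3 PAIR of record «sub-threshold ⟹ plaquettes of `□^∼`
    -- small» (core, from `u < θ`) + «`F ≠ 0` ⟹ collar plaquettes small» (the density's KEPT co-tests — a SUPPORT property) —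
    -- located, printed TYPE, NOT asserted) — REPLACES the window-support binder `hFsupp` of S80 f3 ∕ S76 f2
    (hreach' : ∀ V y, u (fixTo T U₀ (updateFinset V Λ y)) < εθ * η ^ 2 → F (fixTo T U₀ (updateFinset V Λ y)) ≠ 0 →
      ∀ b (hb : b ∈ Λ), dist1 ((c V b)⁻¹ * y ⟨b, hb⟩) ≤ 2 * Real.sin (S / 2))
    (hs₁ : κc * ((ε₄ + B₀ * (2 * dL * C₁ * ε₁)) + B₀ * (4 * C₂ * (ε₄ + B₀ * (2 * dL * C₁ * ε₁)) ^ 2)) ≤ c₁ * η ^ 2 * z)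
    (ha : κr * ((ε₄ + B₀ * (2 * dL * C₁ * ε₁)) + B₀ * (4 * C₂ * (ε₄ + B₀ * (2 * dL * C₁ * ε₁)) ^ 2)) ≤ c₂ * η * z)
    (hma : m * (κr * ((ε₄ + B₀ * (2 * dL * C₁ * ε₁)) + B₀ * (4 * C₂ * (ε₄ + B₀ * (2 * dL * C₁ * ε₁)) ^ 2))) ≤ 1)
    (hsm : 36 * (c₁ * z + m ^ 2 * c₂ ^ 2 * z ^ 2) / (rΦ / S - 1) ^ 2 ≤ δ * εθ) :
    SlotAntiConcentration ((fieldMeasure P j SU2).withDensity F) u (εθ * η ^ 2) ρ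
      (2 * ((m₀ : ℝ) + (3 * (|β| * ((dbar +
          2 * (κcb * (cH₁ * MH₁ * bw / ((1 - c𝒢 * M𝒢 * (2 * C₄w * a₃w * Real.exp (δw * rW))) *
              (1 - 2 * C₂w * RCw * Real.exp (δw * rC) * (cι * Mι) * (cH * MH)))) +
            expTail₂ (mw * (κwb * (cH₁ * MH₁ * bw / ((1 - c𝒢 * M𝒢 * (2 * C₄w * a₃w * Real.exp (δw * rW))) *
              (1 - 2 * C₂w * RCw * Real.exp (δw * rC) * (cι * Mι) * (cH * MH))))))) / (rΦw / S)) *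
          (2 * (κcb * (cH₁ * MH₁ * bw / ((1 - c𝒢 * M𝒢 * (2 * C₄w * a₃w * Real.exp (δw * rW))) *
              (1 - 2 * C₂w * RCw * Real.exp (δw * rC) * (cι * Mι) * (cH * MH)))) +
            expTail₂ (mw * (κwb * (cH₁ * MH₁ * bw / ((1 - c𝒢 * M𝒢 * (2 * C₄w * a₃w * Real.exp (δw * rW))) *
              (1 - 2 * C₂w * RCw * Real.exp (δw * rC) * (cι * Mι) * (cH * MH))))))) / (rΦw / S))) * Kw) +
        (3 * (LK * (2 * ((ε₄e + B₀e * be) + B₀e * (4 * C₂e * (ε₄e + B₀e * be) ^ 2)))) / (rΦe / S - 1) + Bd))) / (1 - δ)) := by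
  have hSrw : S < rΦw := by linarith
  have hRade : 1 < rΦe / S := by rw [lt_div_iff₀ hS]; linarith
  have hzE : 0 ≤ ((ε₄e + B₀e * be) + B₀e * (4 * C₂e * (ε₄e + B₀e * be) ^ 2)) := by positivity
  -- sizes for the located second-order Wilson constant and for the profile's nonnegativity
  have hbw : 0 ≤ bw := (norm_nonneg _).trans (hΦbw U₀ 0 (mem_ball_self (by linarith))).le
  have hεw : 0 ≤ ε₄w + B₀w * bw := add_nonneg hε₄w (mul_nonneg hB₀w.le hbw)
  have hRCw3 : 3 * (ε₄w + B₀w * bw) ≤ RCw := by linarith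
  have hBW : 0 ≤ 3 * (|β| * ((dbar +
          2 * (κcb * (cH₁ * MH₁ * bw / ((1 - c𝒢 * M𝒢 * (2 * C₄w * a₃w * Real.exp (δw * rW))) *
              (1 - 2 * C₂w * RCw * Real.exp (δw * rC) * (cι * Mι) * (cH * MH)))) +
            expTail₂ (mw * (κwb * (cH₁ * MH₁ * bw / ((1 - c𝒢 * M𝒢 * (2 * C₄w * a₃w * Real.exp (δw * rW))) *
              (1 - 2 * C₂w * RCw * Real.exp (δw * rC) * (cι * Mι) * (cH * MH))))))) / (rΦw / S)) *
          (2 * (κcb * (cH₁ * MH₁ * bw / ((1 - c𝒢 * M𝒢 * (2 * C₄w * a₃w * Real.exp (δw * rW))) *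
              (1 - 2 * C₂w * RCw * Real.exp (δw * rC) * (cι * Mι) * (cH * MH)))) +
            expTail₂ (mw * (κwb * (cH₁ * MH₁ * bw / ((1 - c𝒢 * M𝒢 * (2 * C₄w * a₃w * Real.exp (δw * rW))) *
              (1 - 2 * C₂w * RCw * Real.exp (δw * rC) * (cι * Mι) * (cH * MH))))))) / (rΦw / S))) * Kw) := by
    have hKw0 : 0 ≤ Kw := (Finset.sum_nonneg fun _ _ => Real.exp_nonneg _).trans hKw
    have hk1 : 0 < 1 - 2 * C₂w * RCw * Real.exp (δw * rC) * (cι * Mι) * (cH * MH) := by linarith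
    have hs1 : 0 < 1 - c𝒢 * M𝒢 * (2 * C₄w * a₃w * Real.exp (δw * rW)) := by linarith
    have hz : 0 ≤ (cH₁ * MH₁ * bw / ((1 - c𝒢 * M𝒢 * (2 * C₄w * a₃w * Real.exp (δw * rW))) *
              (1 - 2 * C₂w * RCw * Real.exp (δw * rC) * (cι * Mι) * (cH * MH)))) :=
      div_nonneg (mul_nonneg (mul_nonneg hcH₁ hMH₁) hbw) (mul_pos hs1 hk1).le
    have hSbar : 0 ≤ (κcb * (cH₁ * MH₁ * bw / ((1 - c𝒢 * M𝒢 * (2 * C₄w * a₃w * Real.exp (δw * rW))) *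
          (1 - 2 * C₂w * RCw * Real.exp (δw * rC) * (cι * Mι) * (cH * MH)))) +
        expTail₂ (mw * (κwb * (cH₁ * MH₁ * bw / ((1 - c𝒢 * M𝒢 * (2 * C₄w * a₃w * Real.exp (δw * rW))) *
          (1 - 2 * C₂w * RCw * Real.exp (δw * rC) * (cι * Mι) * (cH * MH))))))) :=
      add_nonneg (mul_nonneg hκcb hz) (T4ShellMeasurePlaquette.expTail₂_nonneg _)
    have hRad : 0 < rΦw / S := div_pos (by linarith) hS
    have h2S' : 0 ≤ 2 * (κcb * (cH₁ * MH₁ * bw / ((1 - c𝒢 * M𝒢 * (2 * C₄w * a₃w * Real.exp (δw * rW))) *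
              (1 - 2 * C₂w * RCw * Real.exp (δw * rC) * (cι * Mι) * (cH * MH)))) +
            expTail₂ (mw * (κwb * (cH₁ * MH₁ * bw / ((1 - c𝒢 * M𝒢 * (2 * C₄w * a₃w * Real.exp (δw * rW))) *
              (1 - 2 * C₂w * RCw * Real.exp (δw * rC) * (cι * Mι) * (cH * MH))))))) / (rΦw / S) :=
      div_nonneg (mul_nonneg zero_le_two hSbar) hRad.le
    exact mul_nonneg (by norm_num) (mul_nonneg (mul_nonneg (abs_nonneg β)
      (mul_nonneg (add_nonneg hdbar h2S') h2S')) hKw0)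
  have hBE : 0 ≤ 3 * (LK * (2 * ((ε₄e + B₀e * be) + B₀e * (4 * C₂e * (ε₄e + B₀e * be) ^ 2)))) / (rΦe / S - 1) + Bd :=
    add_nonneg (div_nonneg (by positivity) (by linarith)) hBd0
  refine slotAC_realized_su2_landauChart_final_of_reach' hT U₀ Λ e hS hSπ c hF hFi hu hui hPu W Jco 𝒢 W𝒱 h𝒢 hW hB₀
    hC₄ hε₄ hdL hC₁ hε₁ hB₃ h1 h2 h3 H₁ hH₁ Φ hΦd hΦ0 hΦ hSr Cf hC₂ hCq hCd ιs hι Hop hH h18 hcoup h3R ℓs hκ hℓ hlen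
    hκc hcurl
    (fun V y => ∑ p ∈ Pw, β * (1 - (Matrix.trace (Bp V p * holOf (ℓw p)
      (fun y => landauExp (Cw V) (kerOp (kι V)) (kerOp (kH V)) (4 * C₂w * (ε₄w + B₀w * bw) ^ 2)
        (solAt (kerOp (k𝒢 V)) 0 (W𝒱w V) ε₄w (0 : Λz → ℭ) (kerOp (kH₁ V) (Φw V (cplx y))) +
          kerOp (kH₁ V) (Φw V (cplx y)))) y)).re /
          Fintype.card n))
    (fun V y => (∑ i ∈ I, Ef i (WSup.toPiL (𝔄 := 𝔄) (pinW δ' ϖ) 1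
      (landauExp (Ce V) (ιe V) (He V) (4 * C₂e * (ε₄e + B₀e * be) ^ 2)
        (solAt (𝒢e V) 0 (W𝒱e V) ε₄e (0 : 𝒵e) (H₁e V (Φe V (cplx y))) + H₁e V (Φe V (cplx y)))))).re +
      (-Real.log (∫ ω, g ω * Real.exp (A V y ω) ∂μ)))
    (BElb := BE₁ + BE₂)
    (fun V x hx c' hc hc1 => ?_) hBW (fun V x hx c' hc hc1 => ?_) hBE (fun V y hy => ?_) (fun V y hy => ?_)
    L 𝓡𝒵 𝓡𝒴' 𝓡𝒳 h𝓡𝒳 𝓡ℬ h𝒢r hWr hιr hHr hCr hH₁r hΦr (fun V x hx => by simpa only using hRdict V x hx) hudict hJW hJ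
    hJ1 hWS hδ0 hδ1 hρ0 hρ hβ hη hεθ hreach' hs₁ ha hma hsm
  · -- the WILSON slot AT THE READING OF RECORD, TWO RADII, LOCATED: file 4 `…_located_schwarz_of_decay` per exterior section
    exact hE_landau_wilsonSquares_located_schwarz_of_decay hS (hWS V) hδw ϖw dis hϖw pos posz pos' posx posb (k𝒢 V) (kι V)
      (kH V) (kH₁ V) hc𝒢 hM𝒢 (hk𝒢 V) hM𝒢' hcι hMι (hkι V) hMι' hcH hMH (hkH V) hMH' hcH₁ hMH₁ (hkH₁ V) hMH₁' (h𝒢w V)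
      (hWw V) hB₀w hC₄w hε₄w hdomw hselfw hcontrw (hH₁w V) (hΦdw V) (hΦ0w V) (hΦbw V) h2Sw hC₂w (hCqw V) (hCdw V)
      (hιw V) (hHw V) hqw hRCw NW (hlocW V) hreachW NC (hlocC V) hreachC (hsupp V) hqW hk ℓw suppw ϖPw hblindw hdepthw
      hϖPw hκwb hκcb hℓwb hcurlw hlenw 𝓡𝒴w h𝓡𝒴w 𝓡𝒵w 𝓡𝒴w' 𝓡𝒳w h𝓡𝒳w 𝓡ℬw (h𝒢rw V) (hWrw V) (hιrw V) (hHrw V)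
      (hCrw V) (hH₁rw V) (hΦrw V) hskew (Bp V) (hBu V) (hBd V) hd hdbar hKw β x hx c' hc hc1
  · -- the NON-WILSON slot: S71 f2 located terms ⊕ S78 dressed terms (`rayBound_add`)
    have h1 := hE_landau_chartRay_pinned hδ' hϖ hS (hWS V) (h𝒢e V) (hWe V) hB₀e hC₄e hε₄e hdome hselfe hcontre
      (H₁e V) (hH₁e V) (hΦde V) (hΦ0e V) (hΦbe V) hSre hC₂e (hCqe V) (hCde V) (ιe V) (hιe V) (He V) (hHe V) hqe hRCe
      I hrE hEd hEb he0 supp hblind ϖP hdepth hK hcoupE x hx c' hc hc1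
    have h2 := rayBound_of_logIntegral μ hg (A V) (hint V) (hpos V) (hA V) x hx c' hc hc1
    simp only at h1 h2 ⊢
    linarith
  · -- the Wilson profile is nonnegative at real chart points (S80 §1b BY NAME)
    exact wilsonProfile_nonneg Pw (h𝒢w V) (hWw V) hB₀w hC₄w hε₄w hdomw hselfw hcontrw (kerOp (kH₁ V)) (hH₁w V)
      (hΦbw V) hSrw hC₂w (hCqw V) (hCdw V) (kerOp (kι V)) (hιw V) (kerOp (kH V)) (hHw V) hqw hRCw3 ℓw 𝓡𝒴w h𝓡𝒴w 𝓡𝒵w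
      𝓡𝒴w' 𝓡𝒳w h𝓡𝒳w 𝓡ℬw (h𝒢rw V) (hWrw V) (hιrw V) (hHrw V) (hCrw V) (hH₁rw V) (hΦrw V) hskew (Bp V) (hBu V) hβ hy
  · -- the lower bound of the non-Wilson part
    have h1 := hElb₁ V y hy
    have h2 := hElb₂ V y hy
    linarith

end Assembled

end Summit.QuantumFields.BalabanUV.T4Continuum.ShellMeasureLandauEndAssembledDecayReach

end
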